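/-
Copyright (c) 2026 the pub-hodgecm-mathlib formalisation cell (harness21).  Prover seat hodgecm-mathlib-F0P2-p09 (g3), Track B «K2-LIT» helper hand,
#184♮ = hLiu418 = `stmt-HodgeConjecture-24832`; socket #41, KIND W, (iii-fin) letter (R) = (KW-fin-stab): THE PLACE FUNCTIONS OF KAREL'S RADIUS
(architect K2E3-p06 (g7) spec 2026-09-05T01:40:55Z + 01:46:34Z (iii) + 01:50:47Z (2); KW desk F0P2-p08 (g4) 01:42:45Z (a); LEAD F0P6-plan (g15)).
THEOREMS ONLY (no `def`, no `instance`, no notation, no named-fact hypothesis, no `sorry`).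
-/
import Summits.HodgeConjecture.HodgeConjecture.Theorems.K2LiuFiniteGoodPlacePackage        -- ★ (η) p863794 `exists_goodPlaceFinset` (the good-place finite set of the datum)
import Summits.HodgeConjecture.HodgeConjecture.Theorems.K2LiuBadPlaceWhittakerData         -- ★ Φ5-data `exists_two_threshold`, `exists_mball_neg`, `exists_skewUnit` (+ ★ F3c-1 balls)
import Summits.HodgeConjecture.HodgeConjecture.Theorems.K2LiuBadPlaceLocalFactorSkew        -- ★ `exists_hasConductorExp_adeleAddCharAt` (Tate's `ψ_{L⁺,v}` has a conductor at every place)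
import Literature.NumberTheory.GelbartRogawski1991.LocalKudlaSplittingInjectiveTransported  -- ★ `gramR_eq_diagonal` (generic rank)
import HarnessLib

/-!
# Crux `HLiu418`, socket #41, (KW-fin-stab) — `K2LiuKindWFiniteRadiusPlaceFunctions`: THE PLACE FUNCTIONS `d, c₂, b_T, c_ε, ε` OF KAREL'S EXPLICIT RADIUS,
# FINITELY SUPPORTED, WITH THEIR PER-PLACE LETTERS IN ★ p864173's BINDER BYTES

Cell `hodgecm-mathlib`, crux item hLiu418 = `stmt-HodgeConjecture-24832` (helper lane `--supports … --as helper`, count-neutral), route of record `HCCMUnconditional`;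
squad K2 ∕ K2Liu (L1, LEAD F0P6-plan (g15)), road `K2_Liu`, socket #41, KIND W, (iii-fin) letter (R) `hstab` of ★ p863720 `K2LiuKindWFiniteSizeLetterOfPlace.hsizeLoc_of_place`.
THE POINT (architect K2E3-p06 (g7), note #1 2026-09-05T01:33:21Z): the (iii-fin) radius-stability letter needs `ρ w = 0` off a FIXED finite set of places while `v` ranges with
`(S, h)`, so every constant inside Karel's radius `max j₀ 0 + max j₁ 0 + |d| + 2|c_ε| + 2|c₂| + 2|b_T| + 2 + Σ_w M_w + 4b + 2b′` (★ p864173 `setIntegral_farShell_eq_zero_of_radii`,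
★ p864297∕p864318 `whittaker_setIntegral_ball_(eq|stable)_of_radii`) must be an explicit FINITELY SUPPORTED function of the place.  THIS FILE delivers, at the CM frame
`(L⁺ = Fp L, L, complexConj, v, n, gramR, hermD)` of the K2Lit datum `(L, e, dV, dW)` (non-zero diagonal entries) and for a family of uniformisers `π_v` of the `L⁺_v`:
* **`exists_radius_place_functions`** — `∃ Bad (d c₂ bT cε : 𝔭_{L⁺} → ℤ) (ε : ∀ v, L ⊗ L⁺_v)`, vanishing off `Bad`, `c₂ bT cε ≥ 0` everywhere, and AT EVERY `v` the letters of ★ p864173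
  VERBATIM: Tate's `ψ_{L⁺,v}` has conductor exponent `d v`; `|ι_w π_v|^{c₂ v} ≤ |2|_w`; the Gram matrix `gramS = gramR ⊗ 1` and its inverse lie in `ball(−bT v)`; `ε v` is `σ`-anti-invariant,
  integral, with `|ι_w π_v|^{cε v} ≤ |2 ε v|_w`.
  GOOD places (`v ∉ Bad`, ★ (η) `exists_goodPlaceFinset`: conductor `0`, `|2|_w = |δ|_w = 1`, the diagonal Gram entries `g_k` are `v`-units): `d = c₂ = bT = cε = 0`, `ε v := δ ⊗ 1`
  (`δ = imagUnit L`, ★ `complexConj_imagUnit`, ★ `conjLocal_algebraMap`); `gramS = diagonal (ι_v g_k)` (★ `gramR_eq_diagonal`) with unit entries and `gramS⁻¹ = diagonal ((ι_v g_k)⁻¹)`.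
  BAD places: ★ `exists_hasConductorExp_adeleAddCharAt`, ★ Φ5-data `exists_two_threshold` ∕ `exists_mball_neg` ∕ `exists_skewUnit`, exponents raised to `max · 0` (antitone in the
  exponent since `|ι_w π_v| ≤ 1`, ★ F3c-1).
* §1 tools: `zpow_antitone_toPlace` (raising an exponent), `gramS_eq_diagonal`, `valued_toLocalRing_algebraMap`, `diagonal_inv_of_forall_ne_zero` (inverse of a diagonal of pointwise
  units in `∏_w L_w`).
NOT HERE: the χ-conductor letter `(Tχ, cχ, hχc)` (K2E3-p37 (g3)'s `K2LiuHeckeLocalConductorLetters`), the radius `Kc v` and `(TK, Kg)` (defined in K2E3-p06's closed head).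
[WeilBNT1967, Ch. IV §2 Cor. 1 of Th. 3] [CasselsFrohlichANT1967, Ch. II §10, Ch. XV §3.1] [Shimura1997, §18.3–18.4] [Casselman1980, §3].
HONEST LABEL.  Count-neutral helper, closes no socket by itself: `HC_CM` is proved only modulo the 7 printed citations (2 remaining named inputs:
hLiu418 = `stmt-HodgeConjecture-24832`, h413 = `stmt-HodgeConjecture-24833`) until rung 0 closes.

## References
* [WeilBNT1967] A. Weil, *Basic Number Theory* (1967): Ch. IV §2, Cor. 1 of Th. 3 (local components of a global additive character are unramified almost everywhere).
* [CasselsFrohlichANT1967] Cassels–Fröhlich (eds.), *Algebraic Number Theory* (1967): Ch. II §10 (`|ι_w x|_w = |x|_v^{e(w|v)}`), Ch. XV (Tate) §3.1 (units almost everywhere).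
* [Shimura1997] G. Shimura, *Euler products and Eisenstein series*, CBMS 93 (1997): §18.3–18.4 (local Whittaker coefficients at bad places).
* [Casselman1980] W. Casselman, Compositio Math. 40 (1980): §3.
-/

set_option autoImplicit false
-- the mandated namespace repeats the single-problem summit's segment (`HodgeConjecture.HodgeConjecture`)
set_option linter.dupNamespace false

noncomputable section

open scoped Matrix
open NumberField IsDedekindDomain Matrix
open Literature.NumberTheory.Automorphic Literature.NumberTheory.Automorphic.UnitaryGroup Literature.NumberTheory.GaloisRepresentations
open Literature.NumberTheory.GelbartRogawski1991 Literature.NumberTheory.GelbartRogawski1991.GRConstruction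
open Literature.NumberTheory.GelbartRogawski1991.UnitaryDualPair
open Literature.NumberTheory.K2Lit Literature.NumberTheory.K2Lit.SiegelDoubled
open Summit.HodgeConjecture.HodgeConjecture.Cruxes.HLiu418.K2LiuFiniteGoodPlacePackage (exists_goodPlaceFinset)
open Summit.HodgeConjecture.HodgeConjecture.Cruxes.HLiu418.K2LiuBadPlaceWhittakerData (exists_two_threshold exists_mball_neg exists_skewUnit)
open Summit.HodgeConjecture.HodgeConjecture.Cruxes.HLiu418.K2LiuBadPlaceLocalFactorSkew (exists_hasConductorExp_adeleAddCharAt)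
open Summit.HodgeConjecture.HodgeConjecture.Cruxes.HLiu418.K2LiuLocalRingValuationBalls (mball_antitone valued_toPlace_uniformizer_ne_zero
  valued_toPlace_uniformizer_le_one)

namespace Summit.HodgeConjecture.HodgeConjecture.Cruxes.HLiu418.K2LiuKindWFiniteRadiusPlaceFunctions

variable (L : Type) [Field L] [NumberField L] [IsCMField L]

/-! ## §1 Tools: raising an exponent; the Gram matrix `gramS = gramR ⊗ 1` is a diagonal of `v`-adic scalars, and so is its inverse -/

section Tools

variable (v : HeightOneSpectrum (𝓞 (Fp L))) {π : v.adicCompletion (Fp L)} (hπ : Valued.v π = WithZero.exp (-1 : ℤ))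

omit [IsCMField L] in
include hπ in
/-- raising the exponent lowers the threshold: `|ι_w π_v|^{c'} ≤ |ι_w π_v|^{c}` for `c ≤ c'` (`0 < |ι_w π_v| ≤ 1`, ★ F3c-1). [cite: CasselsFrohlichANT1967, Ch. II §10] -/
theorem zpow_antitone_toPlace (w : PlacesOver L v) {c c' : ℤ} (h : c ≤ c') :
    Valued.v (toPlace v w π) ^ c' ≤ Valued.v (toPlace v w π) ^ c :=
  zpow_le_zpow_right_of_le_one₀ (zero_lt_iff.2 (valued_toPlace_uniformizer_ne_zero (Fp L) L v hπ w)) (valued_toPlace_uniformizer_le_one (Fp L) L v hπ w) h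

omit [IsCMField L] in
/-- **`gramS = diagonal (ι_v ∘ t)`** when the Gram matrix is `diagonal t` (`gramS T₀ = (T₀ ⊗ 1)`, two `Matrix.diagonal_map`s). [cite: Shimura1997, §18.3] -/
theorem gramS_eq_diagonal {m : ℕ} (t : Fin m → Fp L) :
    LocalSplitting.gramS (Fp L) L v m (Matrix.diagonal t) =
      Matrix.diagonal fun k => toLocalRing L v (algebraMap (Fp L) (v.adicCompletion (Fp L)) (t k)) := by
  rw [LocalSplitting.gramS, Matrix.diagonal_map (map_zero _), Matrix.diagonal_map (map_zero _)]

omit [IsCMField L] in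
/-- the valuation of a diagonal entry of `gramS` at `w ∣ v`: `|ι_w(g)|_w = |g|_v^{e(w|v)}` (★ `valued_toPlace`). [cite: CasselsFrohlichANT1967, Ch. II §10] -/
theorem valued_toLocalRing_algebraMap (w : PlacesOver L v) (g : Fp L) :
    Valued.v (toLocalRing L v (algebraMap (Fp L) (v.adicCompletion (Fp L)) g) w) =
      Valued.v (algebraMap (Fp L) (v.adicCompletion (Fp L)) g) ^ v.asIdeal.ramificationIdx' w.1.asIdeal := by
  rw [toLocalRing_apply, valued_toPlace]

omit [IsCMField L] in
/-- **the inverse of a diagonal of pointwise units of `L ⊗ L⁺_v = ∏_{w∣v} L_w` is the diagonal of the pointwise inverses** (`Matrix.inv_eq_left_inv`).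
[cite: CasselsFrohlichANT1967, Ch. II §10] -/
theorem diagonal_inv_of_forall_ne_zero {m : ℕ} (c : Fin m → LocalRing L v) (hc : ∀ k (w : PlacesOver L v), c k w ≠ 0) :
    (Matrix.diagonal c)⁻¹ = Matrix.diagonal fun k => (c k)⁻¹ := by
  refine Matrix.inv_eq_left_inv ?_
  rw [Matrix.diagonal_mul_diagonal, ← Matrix.diagonal_one]
  congr 1
  funext k
  funext w
  rw [Pi.mul_apply, Pi.inv_apply, Pi.one_apply, inv_mul_cancel₀ (hc k w)]

end Tools

/-! ## §2 The place functions -/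

section Place

variable {N M n : ℕ} (e : Fin N × Fin M ≃ Fin n)
  (dV : Fin N → L) (hdV : ∀ i, IsCMField.complexConj L (dV i) = dV i)
  (dW : Fin M → L) (hdW : ∀ i, IsCMField.complexConj L (dW i) = dW i)

/-- **THE PLACE FUNCTIONS OF KAREL'S RADIUS, FINITELY SUPPORTED, WITH THEIR PER-PLACE LETTERS** (architect K2E3-p06 (g7) spec 2026-09-05T01:40:55Z).  For the K2Lit datum
`(L, e, dV, dW)` with non-zero `dV i`, `dW i` and uniformisers `π_v` (`|π_v|_v = exp(−1)`) of all `L⁺_v`, there are a finite set `Bad` of places of `L⁺`, integer place functions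
`d, c₂, b_T, c_ε` VANISHING OFF `Bad` with `c₂, b_T, c_ε ≥ 0`, and elements `ε v ∈ L ⊗ L⁺_v`, such that AT EVERY finite place `v` of `L⁺` (letters of ★ p864173
`setIntegral_farShell_eq_zero_of_radii` verbatim): `ψ_{L⁺,v} = adeleAddCharAt (Fp L) v` has conductor exponent `d v`; `|ι_w π_v|^{c₂ v} ≤ |2|_w` for all `w ∣ v`; every entry of
`gramS = gramR ⊗ 1` and of `gramS⁻¹` lies in `ball(−b_T v)`; `σ(ε v) = −ε v`, `|ε v|_w ≤ 1`, `|ι_w π_v|^{c_ε v} ≤ |2·ε v|_w`.  Good places by ★ (η) `exists_goodPlaceFinset` with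
`ε v := δ ⊗ 1`; bad places by ★ `exists_hasConductorExp_adeleAddCharAt` and ★ Φ5-data.
[cite: WeilBNT1967, Ch. IV §2, Cor. 1 of Th. 3] [cite: CasselsFrohlichANT1967, Ch. XV (Tate) §3.1] [cite: Shimura1997, §18.3–18.4] -/
theorem exists_radius_place_functions (hdV0 : ∀ i, dV i ≠ 0) (hdW0 : ∀ i, dW i ≠ 0)
    {π : ∀ v : HeightOneSpectrum (𝓞 (Fp L)), v.adicCompletion (Fp L)} (hπ : ∀ v, Valued.v (π v) = WithZero.exp (-1 : ℤ)) :
    ∃ (Bad : Finset (HeightOneSpectrum (𝓞 (Fp L)))) (d c₂ bT cε : HeightOneSpectrum (𝓞 (Fp L)) → ℤ) (ε : ∀ v : HeightOneSpectrum (𝓞 (Fp L)), LocalRing L v),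
      (∀ v, v ∉ Bad → d v = 0 ∧ c₂ v = 0 ∧ bT v = 0 ∧ cε v = 0) ∧
      (∀ v, 0 ≤ c₂ v ∧ 0 ≤ bT v ∧ 0 ≤ cε v) ∧
      ∀ v, (adeleAddCharAt (Fp L) v).HasConductorExp (d v) ∧
        (∀ w : PlacesOver L v, Valued.v (toPlace v w (π v)) ^ c₂ v ≤ Valued.v ((2 : LocalRing L v) w)) ∧
        (∀ i j (w : PlacesOver L v), Valued.v (LocalSplitting.gramS (Fp L) L v n (gramR L e dV hdV dW hdW) i j w) ≤ Valued.v (toPlace v w (π v)) ^ (-bT v)) ∧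
        (∀ i j (w : PlacesOver L v), Valued.v ((LocalSplitting.gramS (Fp L) L v n (gramR L e dV hdV dW hdW))⁻¹ i j w) ≤ Valued.v (toPlace v w (π v)) ^ (-bT v)) ∧
        conjLocal L (IsCMField.complexConj L) v (ε v) = -ε v ∧ (∀ w : PlacesOver L v, Valued.v (ε v w) ≤ 1) ∧
        (∀ w : PlacesOver L v, Valued.v (toPlace v w (π v)) ^ cε v ≤ Valued.v ((2 * ε v) w)) := by
  classical
  -- the diagonal Gram entries are non-zero (`gramR = diagonal (dV·dW ∘ e⁻¹)`)
  obtain ⟨t, ht⟩ : ∃ t : Fin n → Fp L, gramR L e dV hdV dW hdW = Matrix.diagonal t := ⟨_, gramR_eq_diagonal L e dV hdV dW hdW⟩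
  have hg : ∀ k : Fin n, gramR L e dV hdV dW hdW k k ≠ 0 := fun k => by
    rw [gramR_eq_diagonal L e dV hdV dW hdW, Matrix.diagonal_apply_eq]
    intro h
    have h' := congrArg (fun z : Fp L => (z : L)) h
    simp only [MulMemClass.coe_mul, ZeroMemClass.coe_zero] at h'
    exact mul_ne_zero (hdV0 _) (hdW0 _) h'
  have htk : ∀ k : Fin n, t k = gramR L e dV hdV dW hdW k k := fun k => by rw [ht, Matrix.diagonal_apply_eq]
  -- GOOD places: ★ (η)
  obtain ⟨Bad, hBad⟩ := exists_goodPlaceFinset L e dV hdV dW hdW hg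
  -- BAD places: the per-place data, chosen once for every `v`
  choose dψ hdψ using fun v : HeightOneSpectrum (𝓞 (Fp L)) => exists_hasConductorExp_adeleAddCharAt (Fp L) v
  choose c2 hc2 using fun v : HeightOneSpectrum (𝓞 (Fp L)) => exists_two_threshold (Fp L) L v (hπ v)
  choose b1 hb10 hb1 using fun v : HeightOneSpectrum (𝓞 (Fp L)) => exists_mball_neg (Fp L) L v (hπ v) (LocalSplitting.gramS (Fp L) L v n (gramR L e dV hdV dW hdW))
  choose b2 hb20 hb2 using fun v : HeightOneSpectrum (𝓞 (Fp L)) => exists_mball_neg (Fp L) L v (hπ v) (LocalSplitting.gramS (Fp L) L v n (gramR L e dV hdV dW hdW))⁻¹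
  choose εb hεbσ hεbint cεb hεb using fun v : HeightOneSpectrum (𝓞 (Fp L)) =>
    exists_skewUnit (Fp L) L (IsCMField.complexConj L) v (hπ v) (complexConj_imagUnit L) (imagUnit_ne_zero L)
  refine ⟨Bad, fun v => if v ∈ Bad then dψ v else 0, fun v => if v ∈ Bad then max (c2 v) 0 else 0, fun v => if v ∈ Bad then max (b1 v) (b2 v) else 0,
    fun v => if v ∈ Bad then max (cεb v) 0 else 0, fun v => if v ∈ Bad then εb v else algebraMap L (LocalRing L v) (imagUnit L),
    fun v hv => ?_, fun v => ?_, fun v => ?_⟩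
  · simp only [hv, if_false, and_self]
  · by_cases hv : v ∈ Bad
    · simp only [hv, if_true]
      exact ⟨le_max_right _ _, (hb10 v).trans (le_max_left _ _), le_max_right _ _⟩
    · simp only [hv, if_false, le_refl, and_self]
  by_cases hv : v ∈ Bad
  · -- a BAD place: the chosen data, exponents raised to `max · 0`
    simp only [hv, if_true]
    refine ⟨hdψ v, fun w => (zpow_antitone_toPlace L v (hπ v) w (le_max_left _ _)).trans (hc2 v w),
      mball_antitone (Fp L) L v (hπ v) (neg_le_neg (le_max_left _ _)) (hb1 v), mball_antitone (Fp L) L v (hπ v) (neg_le_neg (le_max_right _ _)) (hb2 v),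
      hεbσ v, hεbint v, fun w => (zpow_antitone_toPlace L v (hπ v) w (le_max_left _ _)).trans (hεb v w)⟩
  · -- a GOOD place: ★ (η)'s letters
    simp only [hv, if_false]
    obtain ⟨hψ0, -, -, h2, -, hδ, hgv⟩ := hBad v hv
    -- `gramS = diagonal c` with `v`-unit entries, `gramS⁻¹ = diagonal c⁻¹`
    have hS : LocalSplitting.gramS (Fp L) L v n (gramR L e dV hdV dW hdW) =
        Matrix.diagonal fun k => toLocalRing L v (algebraMap (Fp L) (v.adicCompletion (Fp L)) (t k)) := by
      rw [ht]; exact gramS_eq_diagonal L v t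
    have hcw : ∀ (k : Fin n) (w : PlacesOver L v), Valued.v (toLocalRing L v (algebraMap (Fp L) (v.adicCompletion (Fp L)) (t k)) w) = 1 := fun k w => by
      rw [valued_toLocalRing_algebraMap, htk, hgv k, one_pow]
    have hc0 : ∀ (k : Fin n) (w : PlacesOver L v), toLocalRing L v (algebraMap (Fp L) (v.adicCompletion (Fp L)) (t k)) w ≠ 0 := fun k w h => by
      have h1 := hcw k w
      rw [h, map_zero] at h1
      exact zero_ne_one h1
    have hSinv : (LocalSplitting.gramS (Fp L) L v n (gramR L e dV hdV dW hdW))⁻¹ =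
        Matrix.diagonal fun k => (toLocalRing L v (algebraMap (Fp L) (v.adicCompletion (Fp L)) (t k)))⁻¹ := by
      rw [hS]; exact diagonal_inv_of_forall_ne_zero L v _ hc0
    refine ⟨hψ0, fun w => ?_, fun i j w => ?_, fun i j w => ?_, ?_, fun w => ?_, fun w => ?_⟩
    · -- `|2|_w = 1`
      rw [zpow_zero, Pi.ofNat_apply, ← map_ofNat (algebraMap L (w.1.adicCompletion L)) 2]
      exact (h2 w).ge
    · -- `gramS` entries are integral
      rw [neg_zero, zpow_zero, hS]
      by_cases hij : i = j
      · subst hij; rw [Matrix.diagonal_apply_eq, hcw]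
      · rw [Matrix.diagonal_apply_ne _ hij, Pi.zero_apply, map_zero]; exact zero_le_one
    · -- `gramS⁻¹` entries are integral
      rw [neg_zero, zpow_zero, hSinv]
      by_cases hij : i = j
      · subst hij; rw [Matrix.diagonal_apply_eq, Pi.inv_apply, map_inv₀, hcw, inv_one]
      · rw [Matrix.diagonal_apply_ne _ hij, Pi.zero_apply, map_zero]; exact zero_le_one
    · -- `σ(δ ⊗ 1) = −(δ ⊗ 1)`
      rw [conjLocal_algebraMap, complexConj_imagUnit, map_neg]
    · -- `|δ|_w = 1`
      rw [Pi.algebraMap_apply]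
      exact (hδ w).le
    · -- `|2 δ|_w = 1`
      rw [zpow_zero, Pi.mul_apply, Pi.ofNat_apply, Pi.algebraMap_apply, map_mul, ← map_ofNat (algebraMap L (w.1.adicCompletion L)) 2]
      have h2' : Valued.v (algebraMap L (w.1.adicCompletion L) 2) = 1 := h2 w
      have hδ' : Valued.v (algebraMap L (w.1.adicCompletion L) (imagUnit L)) = 1 := hδ w
      refine le_of_eq ?_
      rw [hδ', mul_one]
      exact h2'.symm

end Place

end Summit.HodgeConjecture.HodgeConjecture.Cruxes.HLiu418.K2LiuKindWFiniteRadiusPlaceFunctions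

end
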